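import Literature.AlgebraicGeometry.Motives.FaltingsECOfAbelianVarietyProofs
import Literature.AlgebraicGeometry.Motives.TateAbelianFinite
import Literature.AlgebraicGeometry.Motives.TateAbelianFiniteSteps
import HarnessLib

/-!
# Tate's theorem for elliptic curves over a finite field, reduced to the abelian-variety statement

D-0014 keeps `Literature/` sorry-free by stating cited results as named facts. This sibling of
`Literature.AlgebraicGeometry.Motives.FaltingsEC` and of
`Literature.AlgebraicGeometry.Motives.FaltingsECOfAbelianVarietyProofs` (the number-field
transport) proves the two finite-field elliptic-curve named facts

* `Literature.Hodge.mem_span_range_tateModule_map_of_equivariant_of_finite W W' ℓ` (Tate's theorem,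
  `Hom` form, for elliptic curves `E, E'` over a finite field `k` and a prime `ℓ ≠ char k`: every
  `Γ_k`-equivariant `ℤ_ℓ`-linear `T_ℓ E → T_ℓ E'` is a `ℤ_ℓ`-combination of the `T_ℓ φ`,
  `φ : E → E'` an isogeny over `k`; Tate, Invent. Math. 2 (1966), Main Theorem, case
  `A' = E`, `A'' = E'`) and
* `Literature.Hodge.isIsogenous_of_finite_iff_exists_tateModule_hom_ne_zero W W' ℓ` (Tate's isogeny
  criterion for elliptic curves over `k`, the corrected statement of
  `isIsogenous_iff_exists_tateModule_hom_ne_zero_of_finite`: `E ~_k E'` iff there is a non-zero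
  `Γ_k`-equivariant `T_ℓ E → T_ℓ E'`; Tate 1966, Theorem 1; Silverman, *AEC*, III.7.7(a),
  Ex. 5.4(b))

**from** the abelian-variety statement of Tate's Main Theorem for a pair of abelian varieties
`A, A'` over `k` — bijectivity of the Tate map
`AbelianVariety.faltingsTateMap A A' ℓ : ℤ_ℓ ⊗_ℤ Hom_k(A, A') → Hom_{Γ_k}(T_ℓ A, T_ℓ A')` of
`Literature.NumberTheory.DiophantineGeometry.AVIsogenyTate`, entering as the hypothesis
`hT : ∀ [Finite K], (ℓ : K) ≠ 0 → Function.Bijective (faltingsTateMap A A' ℓ)` (spelled out; it is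
the body of the named fact `Literature.Hodge.tate_bijective_of_finite A A' ℓ` of the companion statement
file `Literature.AlgebraicGeometry.Motives.TateAbelianFinite` — Tate, Invent. Math. 2 (1966),
Main Theorem — and the last section restates the two reductions with that named fact as the
hypothesis) — together with the same explicit
*bridge data* as in the number-field file, identifying the Weierstrass curves `W, W'` with the
one-dimensional abelian varieties `A, A'`:

* `eW : A.geomPoints ≃+ W.geomPoints`, `eW' : A'.geomPoints ≃+ W'.geomPoints` — additive
  isomorphisms `A(k̄) ≅ E(k̄)`, `A'(k̄) ≅ E'(k̄)` commuting with `Γ_k` (`heW`, `heW'`);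
* `hHom` — every non-zero `k`-homomorphism `f : A ⟶ A'` acts on points, after transport, as an
  isogeny `φ : E → E'` of Weierstrass curves (`φ (eW P) = eW' (f P)`).

Such data exist for the elliptic curve defined by `W` (its smooth plane cubic model with the
chord–tangent law is an abelian variety of dimension one with `k̄`-points `E(k̄)`; a non-zero
homomorphism of elliptic curves is an isogeny: Silverman, *AEC*, III.3.1, III.3.6, III.4.8), but
Weierstrass cubics are not yet `k`-group schemes in Mathlib, so — exactly as in the number-field
file — the bridge enters as hypotheses and **no `_holds` theorem is asserted**. What the file
settles is that, granted the bridge, the finite-field elliptic-curve facts are the case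
`dim A = dim A' = 1` of Tate's Main Theorem as Tate states it (for abelian varieties), so that
the one deep input of the whole finite-field elliptic-curve cluster
(`FaltingsECIsogenyFiniteProofs`, `FaltingsECCardProofs`, `FaltingsECTateFiniteProofs`,
`FaltingsECTateHomProofs`: the `Hom` form for two *distinct* curves, equivalently the isogeny
criterion, equivalently `#E(k) = #E'(k) ⇒ E ~_k E'`) is located where every printed proof puts
it: Tate's theorem for the abelian surface `E × E'` (Tate 1966, §2: "it suffices to prove the
statement with `A = B`", applied to `A = E × E'`; Milne, *The Work of John Tate*, §4.3.1), resp.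
Deuring's lifting theory (Milne, loc. cit., §4.3: "`H(E, E')` was known for elliptic curves
over a finite field as a consequence of work of Deuring") — neither of which has a formulation
in terms of the two Weierstrass curves alone.

## Contents (all proved)

* `mem_span_range_tateModule_map_of_abelianVariety_of_span`: the `ℓ`-adic transport over an
  arbitrary field `K` — if every `Γ_K`-equivariant `ℤ_ℓ`-linear `T_ℓ A → T_ℓ A'` lies in the
  `ℤ_ℓ`-span of the `T_ℓ f`, `f ∈ Hom_K(A, A')` (hypothesis `hspan`), then every
  `Γ_K`-equivariant `g : T_ℓ E → T_ℓ E'` lies in the `ℤ_ℓ`-span of the `T_ℓ φ`, `φ : E → E'` an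
  isogeny over `K`. (The proof is that of `mem_span_range_tateModule_map_of_abelianVariety` in
  the number-field file, with Faltings' Korollar 1 replaced by the hypothesis `hspan`:
  `g' = T_ℓ(eW'⁻¹) ∘ g ∘ T_ℓ(eW)` is equivariant, lies in the span of the `T_ℓ f`, and
  transporting back turns `T_ℓ f`, `f ≠ 0`, into `T_ℓ φ` by functoriality of `T_ℓ`.)
* `mem_span_range_tateModule_map_of_abelianVariety_of_bijective`: the same from bijectivity of
  `faltingsTateMap A A' ℓ` (over any field), through
  `toLinearMap_mem_span_of_mem_range` of `FaltingsAbelian`.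
* `mem_span_range_tateModule_map_of_equivariant_of_finite_of_abelianVariety`: the named fact
  `mem_span_range_tateModule_map_of_equivariant_of_finite W W' ℓ` from `hT` and the bridge.
* `isIsogenous_of_finite_iff_exists_tateModule_hom_ne_zero_of_abelianVariety`: the named fact
  `isIsogenous_of_finite_iff_exists_tateModule_hom_ne_zero W W' ℓ` from `hT` and the bridge (via
  `isIsogenous_iff_exists_tateModule_hom_ne_zero_of_finite_of_tate` of `FaltingsECIsogenyProofs`:
  a non-zero element of the span forces an isogeny to exist; the forward direction is
  unconditional, *AEC* III.7.4).
* `mem_span_range_tateModule_map_of_equivariant_of_finite_of_tate_bijective_of_finite` and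
  `isIsogenous_of_finite_iff_exists_tateModule_hom_ne_zero_of_tate_bijective_of_finite`: the same
  two named facts from the *named* fact `Literature.Hodge.tate_bijective_of_finite A A' ℓ`
  (`TateAbelianFinite`; hodge.S27, finite-field half) and the bridge — so that, granted the
  bridge, `isIsogenous_of_finite_iff_exists_tateModule_hom_ne_zero_holds` is exactly one named
  fact away: Tate's Main Theorem for the pair of abelian varieties `(A, A')`.
* **From Tate's lattice lemma for `E × E'` (section `LatticeLemma`).**
  `isIsogenous_of_tateModule_hom_ne_zero_of_tateSubspaceRealization` and
  `isIsogenous_of_finite_iff_exists_tateModule_hom_ne_zero_of_tateSubspaceRealization`: the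
  named fact `isIsogenous_of_finite_iff_exists_tateModule_hom_ne_zero W W' ℓ` from a strictly
  smaller deep input than the Main Theorem for `(A, A')` — Tate's *lattice lemma* for the single
  abelian variety `A × A'` (hypothesis `hW : Literature.Hodge.tateSubspaceRealization b.pt ℓ` of
  `Literature.AlgebraicGeometry.Motives.TateAbelianFiniteSteps`, for a biproduct bicone `b` of
  `(A, A')`: every `Γ_k`-stable `ℚ_ℓ`-subspace of `V_ℓ(A × A')` is `u(V_ℓ(A × A'))` for some
  `u ∈ End_k(A × A') ⊗ ℚ_ℓ`; Tate 1966, §2; Milne, *The Work of John Tate*, §4.3.1 (b); Kieffer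
  2024, Lemma 1.2.23), through the graph argument proved there
  (`exists_hom_ne_zero_or_of_tateSubspaceRealization_of_tateModule`: a non-zero equivariant
  `T_ℓ A → T_ℓ A'` gives `Hom_k(A, A') ≠ 0 ∨ Hom_k(A', A) ≠ 0`), the bridge in both directions
  (`hHom`, `hHom'`, existence of the isogeny only) and the dual-isogeny fact
  `Isogeny.nonempty_symm` for `(E', E)` (*AEC* III.6.1). No double centraliser, no
  semisimplicity of `End ⊗ ℚ_ℓ`, no saturation is needed for the isogeny criterion.
  `isIsogenous_of_exists_isogeny_comp` feeds `hHom` from the pointwise bridge hypothesis of the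
  earlier sections.
* `mem_span_range_tateEndRingHom_iff_of_finite_of_abelianVariety` is **not** included (the `End`
  form is reduced to the `Hom` form for `W' = W` by
  `mem_span_range_tateEndRingHom_iff_of_finite_of_hom` in `FaltingsECTateFiniteProofs`, which
  this file does not import).

## References

* [Tate1966Endomorphisms] J. Tate, *Endomorphisms of abelian varieties over finite fields*,
  Invent. Math. 2 (1966), 134–144: Main Theorem (bijectivity of
  `ℤ_ℓ ⊗ Hom_k(A', A'') → Hom_G(T_ℓ A', T_ℓ A'')` for `k` finite, `ℓ ≠ char k`), Theorem 1
  (the isogeny criterion). Paper not held; statements as reported in the next item.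
* [Milne2013WorkOfTate] J. S. Milne, *The Work of John Tate*, in: The Abel Prize 2008–2012,
  Springer 2014 (arXiv:1210.7459), §4.3 "Homomorphisms of abelian varieties" (statement
  `H(A, B)`; "Tate (1966b) proved `H(A, B)` for all abelian varieties over finite fields";
  `T¹(E × E') ⟺ H(E, E')`; Deuring) and §4.3.1 "Tate's proof of `H(A, B)` over a finite
  field" ("It suffices to prove the statement with `A = B`"), pp. 22–23 of the arXiv version.
* [SilvermanAEC2009] J. H. Silverman, *The Arithmetic of Elliptic Curves*, 2nd ed., GTM 106:
  III.3.1, III.3.6, III.4.8 (the bridge), III.7.4, Isogeny Theorem III.7.7(a), Ex. 5.4(b).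
* [Kieffer2024IsogenyGraphs] J. Kieffer, *Isogeny graphs of abelian varieties over finite
  fields*, lecture notes (2024), §1.2.4: Lemma 1.2.23 (the lattice lemma), Prop. 1.2.20
  (`Hom` from `End(A × B)`), Thm. 1.2.11; held.

## Design

Pure theorems, no definitions, no new named facts; `noncomputable section`,
`namespace Literature.Hodge`, universe-monomorphic `K : Type u` (forced by `AbelianVariety`), variable
conventions and bridge hypotheses literally those of `FaltingsECOfAbelianVarietyProofs`, whose
transport lemmas (`tateModule_map_smul_of_equivariant`, `tateModule_map_comp_symm`,
`tateModule_map_symm_comp`) are reused.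
-/

noncomputable section

universe u

namespace Literature.AlgebraicGeometry.Motives

open WeierstrassCurve AbelianVariety

variable {K : Type u} [Field K] {W W' : WeierstrassCurve K} {A A' : AbelianVariety K}
variable (ℓ : ℕ) [Fact ℓ.Prime]

/-- **The `ℓ`-adic transport, over any field.** Let `W, W'` be Weierstrass curves and `A, A'`
abelian varieties over a field `K`, with `Γ_K`-equivariant additive isomorphisms
`eW : A(K̄) ≅ E(K̄)`, `eW' : A'(K̄) ≅ E'(K̄)` such that every non-zero `f ∈ Hom_K(A, A')`
corresponds to an isogeny `E → E'` (`hHom`). If every `Γ_K`-equivariant `ℤ_ℓ`-linear map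
`T_ℓ A → T_ℓ A'` lies in the `ℤ_ℓ`-span of the maps `T_ℓ f`, `f ∈ Hom_K(A, A')` (`hspan`: the
surjectivity of `ℤ_ℓ ⊗ Hom_K(A, A') → Hom_{Γ_K}(T_ℓ A, T_ℓ A')` in span form), then every
`Γ_K`-equivariant `ℤ_ℓ`-linear `g : T_ℓ E → T_ℓ E'` lies in the `ℤ_ℓ`-span of the maps `T_ℓ φ`,
`φ : E → E'` an isogeny over `K`: `g' = T_ℓ(eW'⁻¹) ∘ g ∘ T_ℓ(eW)` is equivariant, so
`g' = Σ cᵢ T_ℓ fᵢ`, and `g = T_ℓ(eW') ∘ g' ∘ T_ℓ(eW⁻¹) = Σ cᵢ T_ℓ φᵢ` by functoriality of `T_ℓ`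
(`φᵢ ∘ eW = eW' ∘ fᵢ` for `fᵢ ≠ 0`, and `T_ℓ 0 = 0`). Silverman, *AEC*, III.§7 (functoriality
of `T_ℓ`); Tate, Invent. Math. 2 (1966), §1. [folklore] -/
theorem mem_span_range_tateModule_map_of_abelianVariety_of_span
    (eW : A.geomPoints ≃+ W.geomPoints)
    (heW : ∀ (σ : Field.absoluteGaloisGroup K) (P : A.geomPoints), eW (σ • P) = σ • eW P)
    (eW' : A'.geomPoints ≃+ W'.geomPoints)
    (heW' : ∀ (σ : Field.absoluteGaloisGroup K) (P : A'.geomPoints), eW' (σ • P) = σ • eW' P)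
    (hHom : ∀ f : A ⟶ A', f ≠ 0 →
      ∃ φ : Isogeny W W', ∀ P : A.geomPoints, φ (eW P) = eW' (Hom.geomPointsMap f P))
    (hspan : ∀ g' : A.tateModule ℓ →ₗ[ℤ_[ℓ]] A'.tateModule ℓ,
      (∀ (σ : Field.absoluteGaloisGroup K) (x : A.tateModule ℓ), g' (σ • x) = σ • g' x) →
      g' ∈ Submodule.span ℤ_[ℓ] (Set.range (tateModuleMap ℓ : (A ⟶ A') → _)))
    (g : W.tateModule ℓ →ₗ[ℤ_[ℓ]] W'.tateModule ℓ)
    (hg : ∀ (σ : Field.absoluteGaloisGroup K) (x : W.tateModule ℓ), g (σ • x) = σ • g x) :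
    g ∈ Submodule.span ℤ_[ℓ]
      (Set.range fun φ : Isogeny W W' ↦ Literature.NumberTheory.EllipticCurves.TateModule.map ℓ φ.toAddMonoidHom) := by
  classical
  -- the four transport maps
  set TW : A.tateModule ℓ →ₗ[ℤ_[ℓ]] W.tateModule ℓ :=
    Literature.NumberTheory.EllipticCurves.TateModule.map ℓ (eW : A.geomPoints →+ W.geomPoints) with hTW
  set TWi : W.tateModule ℓ →ₗ[ℤ_[ℓ]] A.tateModule ℓ :=
    Literature.NumberTheory.EllipticCurves.TateModule.map ℓ (eW.symm : W.geomPoints →+ A.geomPoints) with hTWi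
  set TW' : A'.tateModule ℓ →ₗ[ℤ_[ℓ]] W'.tateModule ℓ :=
    Literature.NumberTheory.EllipticCurves.TateModule.map ℓ (eW' : A'.geomPoints →+ W'.geomPoints) with hTW'
  set TWi' : W'.tateModule ℓ →ₗ[ℤ_[ℓ]] A'.tateModule ℓ :=
    Literature.NumberTheory.EllipticCurves.TateModule.map ℓ (eW'.symm : W'.geomPoints →+ A'.geomPoints) with hTWi'
  have hWW : TW.comp TWi = LinearMap.id := tateModule_map_comp_symm ℓ eW
  have hWW' : TW'.comp TWi' = LinearMap.id := tateModule_map_comp_symm ℓ eW'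
  -- the transported map is equivariant
  set g' : A.tateModule ℓ →ₗ[ℤ_[ℓ]] A'.tateModule ℓ := (TWi'.comp g).comp TW with hg'
  have heWi' : ∀ (σ : Field.absoluteGaloisGroup K) (Q : W'.geomPoints),
      eW'.symm (σ • Q) = σ • eW'.symm Q := fun σ Q ↦ by
    apply eW'.injective
    rw [heW', eW'.apply_symm_apply, eW'.apply_symm_apply]
  have hg'eq : ∀ (σ : Field.absoluteGaloisGroup K) (x : A.tateModule ℓ),
      g' (σ • x) = σ • g' x := by
    intro σ x
    simp only [hg', LinearMap.comp_apply]
    rw [hTW, tateModule_map_smul_of_equivariant ℓ (eW : A.geomPoints →+ W.geomPoints) heW, hg,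
      hTWi', tateModule_map_smul_of_equivariant ℓ (eW'.symm : W'.geomPoints →+ A'.geomPoints) heWi']
  -- the abelian-variety statement for (A, A')
  have hmem := hspan g' hg'eq
  -- transport back: g = TW' ∘ g' ∘ TWi
  have hgg : g = (TW'.comp g').comp TWi := by
    rw [hg', ← LinearMap.comp_assoc, ← LinearMap.comp_assoc, hWW', LinearMap.id_comp,
      LinearMap.comp_assoc, hWW, LinearMap.comp_id]
  rw [hgg]
  refine Submodule.span_induction ?_ ?_ ?_ ?_ hmem
  · rintro _ ⟨f, rfl⟩
    by_cases hf : f = 0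
    · rw [hf, AbelianVariety.tateModuleMap_zero ℓ, LinearMap.comp_zero, LinearMap.zero_comp]
      exact zero_mem _
    · obtain ⟨φ, hφ⟩ := hHom f hf
      refine Submodule.subset_span ⟨φ, ?_⟩
      -- T φ = TW' ∘ T f ∘ TWi, from φ ∘ eW = eW' ∘ f
      have key : (Literature.NumberTheory.EllipticCurves.TateModule.map ℓ φ.toAddMonoidHom).comp TW =
          TW'.comp (AbelianVariety.tateModuleMap ℓ f) := by
        rw [hTW, hTW', AbelianVariety.tateModuleMap, ← Literature.NumberTheory.EllipticCurves.TateModule.map_comp,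
          ← Literature.NumberTheory.EllipticCurves.TateModule.map_comp]
        congr 1
        ext P
        exact hφ P
      calc Literature.NumberTheory.EllipticCurves.TateModule.map ℓ φ.toAddMonoidHom
          = ((Literature.NumberTheory.EllipticCurves.TateModule.map ℓ φ.toAddMonoidHom).comp TW).comp TWi := by
            rw [LinearMap.comp_assoc, hWW, LinearMap.comp_id]
        _ = (TW'.comp (AbelianVariety.tateModuleMap ℓ f)).comp TWi := by rw [key]
  · rw [LinearMap.comp_zero, LinearMap.zero_comp]; exact zero_mem _
  · intro u v _ _ hu hv
    rw [LinearMap.comp_add, LinearMap.add_comp]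
    exact add_mem hu hv
  · intro c u _ hu
    rw [LinearMap.comp_smul, LinearMap.smul_comp]
    exact Submodule.smul_mem _ c hu

/-- **The `ℓ`-adic transport from bijectivity of the Tate map, over any field.** With bridge
data as in `mem_span_range_tateModule_map_of_abelianVariety_of_span`, if the Tate map
`ℤ_ℓ ⊗ Hom_K(A, A') → Hom_{Γ_K}(T_ℓ A, T_ℓ A')` (`faltingsTateMap A A' ℓ`) is bijective, then
every `Γ_K`-equivariant `ℤ_ℓ`-linear `T_ℓ E → T_ℓ E'` lies in the `ℤ_ℓ`-span of the `T_ℓ φ`,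
`φ : E → E'` an isogeny over `K` (surjectivity gives the span form at the level of `A, A'`:
`toLinearMap_mem_span_of_mem_range` of `FaltingsAbelian`). Only surjectivity is used.
Tate, Invent. Math. 2 (1966), Main Theorem (statement); Silverman, *AEC*, III.7.7. [folklore] -/
theorem mem_span_range_tateModule_map_of_abelianVariety_of_bijective
    (eW : A.geomPoints ≃+ W.geomPoints)
    (heW : ∀ (σ : Field.absoluteGaloisGroup K) (P : A.geomPoints), eW (σ • P) = σ • eW P)
    (eW' : A'.geomPoints ≃+ W'.geomPoints)
    (heW' : ∀ (σ : Field.absoluteGaloisGroup K) (P : A'.geomPoints), eW' (σ • P) = σ • eW' P)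
    (hHom : ∀ f : A ⟶ A', f ≠ 0 →
      ∃ φ : Isogeny W W', ∀ P : A.geomPoints, φ (eW P) = eW' (Hom.geomPointsMap f P))
    (hbij : Function.Bijective (faltingsTateMap A A' ℓ))
    (g : W.tateModule ℓ →ₗ[ℤ_[ℓ]] W'.tateModule ℓ)
    (hg : ∀ (σ : Field.absoluteGaloisGroup K) (x : W.tateModule ℓ), g (σ • x) = σ • g x) :
    g ∈ Submodule.span ℤ_[ℓ]
      (Set.range fun φ : Isogeny W W' ↦ Literature.NumberTheory.EllipticCurves.TateModule.map ℓ φ.toAddMonoidHom) := by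
  refine mem_span_range_tateModule_map_of_abelianVariety_of_span ℓ eW heW eW' heW' hHom
    (fun g' hg' ↦ ?_) g hg
  obtain ⟨t, ht⟩ :=
    hbij.2 (g'.intertwiningMap_of_isIntertwiningMap (A.tateRep ℓ) (A'.tateRep ℓ) hg')
  have := toLinearMap_mem_span_of_mem_range ℓ ⟨t, ht⟩
  exact this

variable (W W') in
/-- **Tate's theorem (`Hom` form) for elliptic curves over a finite field from Tate's Main
Theorem for abelian varieties.** With bridge data as above, the named fact
`Literature.Hodge.mem_span_range_tateModule_map_of_equivariant_of_finite W W' ℓ` (for `k` finite and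
`ℓ ≠ char k`, every `Γ_k`-equivariant `ℤ_ℓ`-linear `T_ℓ E → T_ℓ E'` is a `ℤ_ℓ`-combination of
the `T_ℓ φ`, `φ : E → E'` an isogeny over `k`) follows from the bijectivity of
`ℤ_ℓ ⊗ Hom_k(A, A') → Hom_{Γ_k}(T_ℓ A, T_ℓ A')` for `k` finite, `ℓ ≠ char k` (hypothesis `hT`,
the body of `Literature.Hodge.tate_bijective_of_finite A A' ℓ`: Tate, Invent. Math. 2 (1966), Main
Theorem, for `A' = A`, `A'' = A'`). Milne, *The Work of John Tate*, §4.3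
(`T¹(E × E') ⟺ H(E, E')`). [cite: Tate1966Endomorphisms, Main Theorem] -/
theorem mem_span_range_tateModule_map_of_equivariant_of_finite_of_abelianVariety
    (eW : A.geomPoints ≃+ W.geomPoints)
    (heW : ∀ (σ : Field.absoluteGaloisGroup K) (P : A.geomPoints), eW (σ • P) = σ • eW P)
    (eW' : A'.geomPoints ≃+ W'.geomPoints)
    (heW' : ∀ (σ : Field.absoluteGaloisGroup K) (P : A'.geomPoints), eW' (σ • P) = σ • eW' P)
    (hHom : ∀ f : A ⟶ A', f ≠ 0 →
      ∃ φ : Isogeny W W', ∀ P : A.geomPoints, φ (eW P) = eW' (Hom.geomPointsMap f P))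
    (hT : ∀ [Finite K], (ℓ : K) ≠ 0 → Function.Bijective (faltingsTateMap A A' ℓ)) :
    mem_span_range_tateModule_map_of_equivariant_of_finite W W' ℓ :=
  fun hℓ f hf ↦
    mem_span_range_tateModule_map_of_abelianVariety_of_bijective ℓ eW heW eW' heW' hHom (hT hℓ) f hf

variable (W W') in
/-- **Tate's isogeny criterion for elliptic curves over a finite field from Tate's Main Theorem
for abelian varieties.** With bridge data as above, the named fact
`Literature.Hodge.isIsogenous_of_finite_iff_exists_tateModule_hom_ne_zero W W' ℓ` — for `k` finite and
`ℓ ≠ char k`, two elliptic curves `E, E'` over `k` are isogenous over `k` iff there is a non-zero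
`Γ_k`-equivariant `ℤ_ℓ`-linear `T_ℓ E → T_ℓ E'` (the corrected statement of the deprecated
`isIsogenous_iff_exists_tateModule_hom_ne_zero_of_finite`) — follows from the bijectivity of
`ℤ_ℓ ⊗ Hom_k(A, A') → Hom_{Γ_k}(T_ℓ A, T_ℓ A')` for `k` finite, `ℓ ≠ char k` (hypothesis `hT`,
the body of `Literature.Hodge.tate_bijective_of_finite A A' ℓ`): the `Hom` form just derived feeds
`isIsogenous_iff_exists_tateModule_hom_ne_zero_of_finite_of_tate` (`FaltingsECIsogenyProofs`: a
non-zero element of the `ℤ_ℓ`-span of the `T_ℓ φ` forces an isogeny `E → E'` to exist; the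
forward direction is `T_ℓ φ ≠ 0`, *AEC* III.7.4). Tate, Invent. Math. 2 (1966), Main Theorem
and Theorem 1; Silverman, *AEC*, III.7.7(a), Ex. 5.4(b).
[cite: Tate1966Endomorphisms, Main Theorem and Thm. 1] -/
theorem isIsogenous_of_finite_iff_exists_tateModule_hom_ne_zero_of_abelianVariety
    (eW : A.geomPoints ≃+ W.geomPoints)
    (heW : ∀ (σ : Field.absoluteGaloisGroup K) (P : A.geomPoints), eW (σ • P) = σ • eW P)
    (eW' : A'.geomPoints ≃+ W'.geomPoints)
    (heW' : ∀ (σ : Field.absoluteGaloisGroup K) (P : A'.geomPoints), eW' (σ • P) = σ • eW' P)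
    (hHom : ∀ f : A ⟶ A', f ≠ 0 →
      ∃ φ : Isogeny W W', ∀ P : A.geomPoints, φ (eW P) = eW' (Hom.geomPointsMap f P))
    (hT : ∀ [Finite K], (ℓ : K) ≠ 0 → Function.Bijective (faltingsTateMap A A' ℓ)) :
    isIsogenous_of_finite_iff_exists_tateModule_hom_ne_zero W W' ℓ :=
  fun hℓ ↦ isIsogenous_iff_exists_tateModule_hom_ne_zero_of_finite_of_tate W W' ℓ hℓ
    (mem_span_range_tateModule_map_of_equivariant_of_finite_of_abelianVariety W W' ℓ eW heW eW'
      heW' hHom hT)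

/-! ## The reductions keyed to the named fact `tate_bijective_of_finite` (hodge.S27, finite fields) -/

variable (W W') in
/-- **Tate's theorem (`Hom` form) for elliptic curves over a finite field from the named fact
`Literature.Hodge.tate_bijective_of_finite A A' ℓ`** (Tate, Invent. Math. 2 (1966), Main Theorem, for
abelian varieties over a finite field; `Literature.AlgebraicGeometry.Motives.TateAbelianFinite`)
and bridge data `eW, eW', hHom` identifying `W, W'` with `A, A'`:
`mem_span_range_tateModule_map_of_equivariant_of_finite W W' ℓ`. This is
`mem_span_range_tateModule_map_of_equivariant_of_finite_of_abelianVariety` with `hT` the named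
fact. [cite: Tate1966Endomorphisms, Main Theorem] -/
theorem mem_span_range_tateModule_map_of_equivariant_of_finite_of_tate_bijective_of_finite
    (eW : A.geomPoints ≃+ W.geomPoints)
    (heW : ∀ (σ : Field.absoluteGaloisGroup K) (P : A.geomPoints), eW (σ • P) = σ • eW P)
    (eW' : A'.geomPoints ≃+ W'.geomPoints)
    (heW' : ∀ (σ : Field.absoluteGaloisGroup K) (P : A'.geomPoints), eW' (σ • P) = σ • eW' P)
    (hHom : ∀ f : A ⟶ A', f ≠ 0 →
      ∃ φ : Isogeny W W', ∀ P : A.geomPoints, φ (eW P) = eW' (Hom.geomPointsMap f P))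
    (hT : tate_bijective_of_finite A A' ℓ) :
    mem_span_range_tateModule_map_of_equivariant_of_finite W W' ℓ :=
  mem_span_range_tateModule_map_of_equivariant_of_finite_of_abelianVariety W W' ℓ eW heW eW' heW'
    hHom fun hℓ ↦ hT hℓ

variable (W W') in
/-- **Tate's isogeny criterion for elliptic curves over a finite field from the named fact
`Literature.Hodge.tate_bijective_of_finite A A' ℓ`** (Tate 1966, Main Theorem, for abelian varieties
over a finite field) and bridge data `eW, eW', hHom`: the corrected named fact
`isIsogenous_of_finite_iff_exists_tateModule_hom_ne_zero W W' ℓ` (for `k` finite, `ℓ ≠ char k`: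
`E ~_k E'` iff some `Γ_k`-equivariant `ℤ_ℓ`-linear `T_ℓ E → T_ℓ E'` is non-zero). Granted the
bridge (the elliptic curve of `W` as a one-dimensional abelian variety: Silverman, *AEC*,
III.3.1, III.3.6, III.4.8 — not yet constructible in Mathlib), the discharge
`isIsogenous_of_finite_iff_exists_tateModule_hom_ne_zero_holds` is therefore exactly
`tate_bijective_of_finite_holds` for the pair `(A, A')`, i.e. Tate's Main Theorem, whose printed
proof runs through the abelian surface `A × A'` (Tate 1966, §2; Milne, *The Work of John Tate*,
§4.3.1). Tate, Invent. Math. 2 (1966), Main Theorem and Theorem 1; Silverman, *AEC*,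
III.7.7(a), Ex. 5.4(b). [cite: Tate1966Endomorphisms, Main Theorem and Thm. 1] -/
theorem isIsogenous_of_finite_iff_exists_tateModule_hom_ne_zero_of_tate_bijective_of_finite
    (eW : A.geomPoints ≃+ W.geomPoints)
    (heW : ∀ (σ : Field.absoluteGaloisGroup K) (P : A.geomPoints), eW (σ • P) = σ • eW P)
    (eW' : A'.geomPoints ≃+ W'.geomPoints)
    (heW' : ∀ (σ : Field.absoluteGaloisGroup K) (P : A'.geomPoints), eW' (σ • P) = σ • eW' P)
    (hHom : ∀ f : A ⟶ A', f ≠ 0 →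
      ∃ φ : Isogeny W W', ∀ P : A.geomPoints, φ (eW P) = eW' (Hom.geomPointsMap f P))
    (hT : tate_bijective_of_finite A A' ℓ) :
    isIsogenous_of_finite_iff_exists_tateModule_hom_ne_zero W W' ℓ :=
  isIsogenous_of_finite_iff_exists_tateModule_hom_ne_zero_of_abelianVariety W W' ℓ eW heW eW' heW'
    hHom fun hℓ ↦ hT hℓ

/-! ## The isogeny criterion from Tate's lattice lemma for `E × E'` -/

section LatticeLemma

open CategoryTheory

variable (W W') in
/-- **An isogeny from a non-zero equivariant map of Tate modules, given Tate's lattice lemma for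
`E × E'` (any field, any prime `ℓ`).** Let `W, W'` be Weierstrass curves and `A, A'` abelian
varieties over `K` with `Γ_K`-equivariant additive isomorphisms `eW : A(K̄) ≅ E(K̄)`,
`eW' : A'(K̄) ≅ E'(K̄)` such that `Hom_K(A, A') ≠ 0` gives an isogeny `E → E'` over `K` (`hHom`)
and `Hom_K(A', A) ≠ 0` an isogeny `E' → E` (`hHom'`, the same bridge for the reversed pair); let
`b` be a biproduct bicone of `(A, A')` (`hb`) whose vertex `b.pt = A × A'` satisfies Tate's
lattice lemma at `ℓ` (`hW : Literature.Hodge.tateSubspaceRealization b.pt ℓ`: every `Γ_K`-stable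
subspace of `V_ℓ(A × A')` is `u(V_ℓ(A × A'))` for some `u ∈ End_K(A × A') ⊗ ℚ_ℓ`), and assume
isogenies can be turned round (`hsymm`, the body of `Isogeny.nonempty_symm` for `(E', E)`:
Silverman, *AEC*, III.6.1, dual isogeny). Then a non-zero `Γ_K`-equivariant `ℤ_ℓ`-linear
`f : T_ℓ E → T_ℓ E'` forces `E ~_K E'`: the transported map
`g = T_ℓ(eW'⁻¹) ∘ f ∘ T_ℓ(eW) : T_ℓ A → T_ℓ A'` is non-zero and equivariant, so by the graph
argument (`Literature.AlgebraicGeometry.Motives.exists_hom_ne_zero_or_of_tateSubspaceRealization_of_tateModule`)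
`Hom_K(A, A') ≠ 0` or `Hom_K(A', A) ≠ 0`, and either alternative yields an isogeny `E → E'`.
Tate, Invent. Math. 2 (1966), §2 and Theorem 1; Kieffer 2024, Lemma 1.2.23 with Prop. 1.2.20;
Silverman, *AEC*, III.7.7(a). [folklore] -/
theorem isIsogenous_of_tateModule_hom_ne_zero_of_tateSubspaceRealization
    (b : CategoryTheory.Limits.BinaryBicone A A') (hb : b.fst ≫ b.inl + b.snd ≫ b.inr = 𝟙 b.pt)
    (hW : tateSubspaceRealization b.pt ℓ)
    (eW : A.geomPoints ≃+ W.geomPoints)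
    (heW : ∀ (σ : Field.absoluteGaloisGroup K) (P : A.geomPoints), eW (σ • P) = σ • eW P)
    (eW' : A'.geomPoints ≃+ W'.geomPoints)
    (heW' : ∀ (σ : Field.absoluteGaloisGroup K) (P : A'.geomPoints), eW' (σ • P) = σ • eW' P)
    (hHom : ∀ f : A ⟶ A', f ≠ 0 → W.IsIsogenous W')
    (hHom' : ∀ f : A' ⟶ A, f ≠ 0 → W'.IsIsogenous W)
    (hsymm : Isogeny.nonempty_symm (W := W') (W' := W))
    {f : W.tateModule ℓ →ₗ[ℤ_[ℓ]] W'.tateModule ℓ} (hf0 : f ≠ 0)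
    (hf : ∀ (σ : Field.absoluteGaloisGroup K) (x : W.tateModule ℓ), f (σ • x) = σ • f x) :
    W.IsIsogenous W' := by
  -- the four transport maps
  set TW : A.tateModule ℓ →ₗ[ℤ_[ℓ]] W.tateModule ℓ :=
    Literature.NumberTheory.EllipticCurves.TateModule.map ℓ (eW : A.geomPoints →+ W.geomPoints) with hTW
  set TWi : W.tateModule ℓ →ₗ[ℤ_[ℓ]] A.tateModule ℓ :=
    Literature.NumberTheory.EllipticCurves.TateModule.map ℓ (eW.symm : W.geomPoints →+ A.geomPoints) with hTWi
  set TW' : A'.tateModule ℓ →ₗ[ℤ_[ℓ]] W'.tateModule ℓ :=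
    Literature.NumberTheory.EllipticCurves.TateModule.map ℓ (eW' : A'.geomPoints →+ W'.geomPoints) with hTW'
  set TWi' : W'.tateModule ℓ →ₗ[ℤ_[ℓ]] A'.tateModule ℓ :=
    Literature.NumberTheory.EllipticCurves.TateModule.map ℓ (eW'.symm : W'.geomPoints →+ A'.geomPoints) with hTWi'
  have hWW : TW.comp TWi = LinearMap.id := tateModule_map_comp_symm ℓ eW
  have hWW' : TW'.comp TWi' = LinearMap.id := tateModule_map_comp_symm ℓ eW'
  -- the transported map `g = T(eW'⁻¹) ∘ f ∘ T(eW)` is equivariant and non-zero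
  set g : A.tateModule ℓ →ₗ[ℤ_[ℓ]] A'.tateModule ℓ := (TWi'.comp f).comp TW with hg
  have heWi' : ∀ (σ : Field.absoluteGaloisGroup K) (Q : W'.geomPoints),
      eW'.symm (σ • Q) = σ • eW'.symm Q := fun σ Q ↦ by
    apply eW'.injective
    rw [heW', eW'.apply_symm_apply, eW'.apply_symm_apply]
  have hgeq : ∀ (σ : Field.absoluteGaloisGroup K) (x : A.tateModule ℓ), g (σ • x) = σ • g x := by
    intro σ x
    simp only [hg, LinearMap.comp_apply]
    rw [hTW, tateModule_map_smul_of_equivariant ℓ (eW : A.geomPoints →+ W.geomPoints) heW, hf,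
      hTWi', tateModule_map_smul_of_equivariant ℓ (eW'.symm : W'.geomPoints →+ A'.geomPoints) heWi']
  have hg0 : g ≠ 0 := by
    intro h0
    apply hf0
    have hff : f = (TW'.comp g).comp TWi := by
      rw [hg, ← LinearMap.comp_assoc, ← LinearMap.comp_assoc, hWW', LinearMap.id_comp,
        LinearMap.comp_assoc, hWW, LinearMap.comp_id]
    rw [hff, h0, LinearMap.comp_zero, LinearMap.zero_comp]
  -- the graph argument at the level of abelian varieties, then back to the curves
  obtain ⟨φ, hφ⟩ | ⟨φ, hφ⟩ :=
    exists_hom_ne_zero_or_of_tateSubspaceRealization_of_tateModule ℓ b hb hW hg0 hgeq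
  · exact hHom φ hφ
  · obtain ⟨ψ⟩ := hHom' φ hφ
    exact hsymm ψ

variable (W W') in
/-- **Tate's isogeny criterion for elliptic curves over a finite field
(`Literature.Hodge.isIsogenous_of_finite_iff_exists_tateModule_hom_ne_zero W W' ℓ`) from Tate's lattice
lemma for the abelian surface `E × E'`.** With bridge data `eW, heW, eW', heW', hHom, hHom'` as in
`isIsogenous_of_tateModule_hom_ne_zero_of_tateSubspaceRealization`, a biproduct bicone `b` of
`(A, A')` (`hb`; from `AbelianVariety.hasBinaryBiproduct A A'` by
`AbelianVariety.exists_binaryBicone_total`), Tate's lattice lemma for `b.pt = A × A'` over the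
finite field `K` at the prime `ℓ ≠ char K` (`hW`: Tate, Invent. Math. 2 (1966), §2; Milne,
*The Work of John Tate*, §4.3.1 (b); Kieffer 2024, Lemma 1.2.23 and Remark 1.2.18 — the one
deep input, to be proved from the finiteness of `K`-isomorphism classes of abelian surfaces over
`K` and the lattice/isogeny dictionary) and the dual-isogeny fact `Isogeny.nonempty_symm` for
`(E', E)` (`hsymm`, *AEC* III.6.1): for `K` finite and `(ℓ : K) ≠ 0`, `E ~_K E'` iff there is a
non-zero `Γ_K`-equivariant `ℤ_ℓ`-linear `T_ℓ E → T_ℓ E'`. (→) is the tree's unconditional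
`exists_tateModule_hom_ne_zero_of_isIsogenous` (*AEC* III.7.4); (←) is
`isIsogenous_of_tateModule_hom_ne_zero_of_tateSubspaceRealization`. Compared with
`isIsogenous_of_finite_iff_exists_tateModule_hom_ne_zero_of_tate_bijective_of_finite`, the deep
hypothesis is no longer Tate's Main Theorem for `(A, A')` but only its lattice lemma for
`A × A'`: no double centraliser, no semisimplicity of `End ⊗ ℚ_ℓ`, no saturation.
Tate 1966, Theorem 1; Silverman, *AEC*, Isogeny Theorem III.7.7(a). [folklore] -/
theorem isIsogenous_of_finite_iff_exists_tateModule_hom_ne_zero_of_tateSubspaceRealization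
    (b : CategoryTheory.Limits.BinaryBicone A A') (hb : b.fst ≫ b.inl + b.snd ≫ b.inr = 𝟙 b.pt)
    (hW : ∀ [Finite K], (ℓ : K) ≠ 0 → tateSubspaceRealization b.pt ℓ)
    (eW : A.geomPoints ≃+ W.geomPoints)
    (heW : ∀ (σ : Field.absoluteGaloisGroup K) (P : A.geomPoints), eW (σ • P) = σ • eW P)
    (eW' : A'.geomPoints ≃+ W'.geomPoints)
    (heW' : ∀ (σ : Field.absoluteGaloisGroup K) (P : A'.geomPoints), eW' (σ • P) = σ • eW' P)
    (hHom : ∀ f : A ⟶ A', f ≠ 0 → W.IsIsogenous W')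
    (hHom' : ∀ f : A' ⟶ A, f ≠ 0 → W'.IsIsogenous W)
    (hsymm : Isogeny.nonempty_symm (W := W') (W' := W)) :
    isIsogenous_of_finite_iff_exists_tateModule_hom_ne_zero W W' ℓ := by
  intro _ _ _ hℓ
  exact ⟨exists_tateModule_hom_ne_zero_of_isIsogenous ℓ hℓ, fun ⟨_, hf0, hf⟩ ↦
    isIsogenous_of_tateModule_hom_ne_zero_of_tateSubspaceRealization W W' ℓ b hb (hW hℓ) eW heW
      eW' heW' hHom hHom' hsymm hf0 hf⟩

/-- The bridge hypothesis `hHom` of this section from the pointwise bridge hypothesis of the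
earlier sections (`∀ f ≠ 0, ∃ φ : Isogeny W W', ∀ P, φ (eW P) = eW' (f P)`): only the existence
of the isogeny is used here. [folklore] -/
theorem isIsogenous_of_exists_isogeny_comp
    {eW : A.geomPoints ≃+ W.geomPoints} {eW' : A'.geomPoints ≃+ W'.geomPoints}
    (hHom : ∀ f : A ⟶ A', f ≠ 0 →
      ∃ φ : Isogeny W W', ∀ P : A.geomPoints, φ (eW P) = eW' (Hom.geomPointsMap f P))
    (f : A ⟶ A') (hf : f ≠ 0) : W.IsIsogenous W' := by
  obtain ⟨φ, -⟩ := hHom f hf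
  exact ⟨φ⟩

end LatticeLemma

end Literature.AlgebraicGeometry.Motives
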